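import Mathlib
import HarnessLib.Audit
import Summits.PneNP.PneNP.Theorems.PstarChordBridgeForcing

/-!
# A fundamental AND-sum is not constant on a small coordinate flat (ROUND-24, memo §9 R4/G2′; tools for "bundles are killable")

FRONTIER range-avoidance ladder, rung F-N3, ROUND 24 (cell `pnp-ideate`, planner memo `r24/CORE-BOUND-NOTES.md` §4 ("bundles … dead by
expansion"), §7 G2′, §9 R4; restricted-model proof complexity — nothing here bears on `P` versus `NP`).

For a FUNDAMENTAL SET `D` (`e ∉ D`, `D + e` everywhere even, `#D ≤ r`; `PstarChordBridge.BridgeData.WF.hD/hDeven`) of a pure `(r,3/2)`-expanding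
instance with simple overlaps, the linear-free AND-sum `Q_D = Σ_{j∈D} x_{p_j} x_{q_j}` cannot be constant on any of the flats

* `{x_p = 0}` (`false_of_const_on_hyperplane`: then every output of `D` contains `p` — a star, `PstarChordBridgeFundamental.not_star_of_even`),
* `{x_p = x_q = 1}` (`false_of_const_on_pair_flat`),
* `{x_σ = 1, x_b + x_{b'} = 1}` when `σ ~ b` in `D` (`false_of_const_on_sigma_flat`).

Mechanism: constancy on a flat `x₀ + W` gives `B_D(w, w') = 0` for `w, w' ∈ W` (`polar_eq_zero_of_const`) and `Q_D(w) = B_D(x₀, w)`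
(`qform_add_polar_eq_zero`, as `Q_D(0) = 0`); with `B_D(e_c, e_d) = [c ~ d]` (`PstarPathRank.polar_basis`) and `Q_D(e_i) = 0` this pins the
AND-graph of `D` down to: no output off the flat's variables, and paired adjacencies (`p ~ i ↔ q ~ i`; `b ~ i ↔ b' ~ i`, `σ ~ i ↔ b ~ i`,
`σ ~ b ↔ σ ~ b'`).  Every such graph is a STAR (excluded by `not_star_of_even`) or ALL-SHARED — every AND variable of every output lies in a
second output (`second_of_pair`, `second_of_sigma`, `shared_of_second`) — and an all-shared fundamental set has at most two boundary
variables (its XOR ends), against `3·#D ≤ 2·#bdry(D)` and `#D ≥ 2` (`false_of_shared`).  These three flats are exactly the sets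
`{Q_S = δ}` for the symmetric difference `S` of two bundled chords (`PstarChordBridgeKill`).
-/

set_option linter.dupNamespace false -- `Summit.PneNP.PneNP.…`: summit = sub-problem name (D-0017 single-conjunct layout)

open Finset Module Literature.Computability.Complexity
open Summit.PneNP.PneNP.Theorems.PstarSALevel (varSet bdry BoundaryExpanding SimpleOverlap)
open Summit.PneNP.PneNP.Theorems.PstarGapLinearised (andPair andPair_subset_varSet)
open Summit.PneNP.PneNP.Theorems.PstarChordEndgameTools (mem_andPair_iff)
open Summit.PneNP.PneNP.Theorems.PstarNorCoreTools (not_mem_bdry_of_two)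
open Summit.PneNP.PneNP.Theorems.PstarProductRank (qform polar)
open Summit.PneNP.PneNP.Theorems.PstarPathRank (AndAdj polar_basis and_ne polar_self_and)
open Summit.PneNP.PneNP.Theorems.PstarChordBridgeTools
open Summit.PneNP.PneNP.Theorems.PstarChordBridgeFundamental (two_le_card_of_even not_star_of_even card_xor_bdry_le_two_of_even)
open Summit.PneNP.PneNP.Theorems.PstarChordBridgeForcing (qform_add')

namespace Summit.PneNP.PneNP.Theorems.PstarChordBridgeFlat

variable {n m : ℕ}

/-! ## Values of an AND-sum at basis vectors, and two consequences of constancy -/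

/-- `Q_D(0) = 0`. -/
theorem qform_zero (I : LocalMap 4 n m) (D : Finset (Fin m)) :
    qform D (fun j => I.vars j 2) (fun j => I.vars j 3) (0 : Fin n → ZMod 2) = 0 := by
  simp only [qform, Pi.zero_apply, mul_zero, sum_const_zero]

/-- `Q_D(e_i) = 0`: the two AND variables of an output are distinct (purity), so no monomial survives at a basis vector. -/
theorem qform_single (I : LocalMap 4 n m) (hI : I.IsPure xorAndPred) (D : Finset (Fin m)) (i : Fin n) :
    qform D (fun j => I.vars j 2) (fun j => I.vars j 3) (Pi.single i (1 : ZMod 2)) = 0 := by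
  unfold qform
  refine sum_eq_zero fun j _ => ?_
  simp only [Pi.single_apply]
  by_cases h2 : I.vars j 2 = i
  · have h3 : I.vars j 3 ≠ i := fun h3 => and_ne I hI j (h2.trans h3.symm)
    rw [if_neg h3, mul_zero]
  · rw [if_neg h2, zero_mul]

/-- `Q_D(e_c + e_d) = [c ~ d in D]` (simple overlaps: at most one output has AND pair `{c, d}`). -/
theorem qform_pair (I : LocalMap 4 n m) (hI : I.IsPure xorAndPred) (hS : SimpleOverlap I) (D : Finset (Fin m)) (c d : Fin n) :
    qform D (fun j => I.vars j 2) (fun j => I.vars j 3) ((Pi.single c (1 : ZMod 2) : Fin n → ZMod 2) + Pi.single d 1) =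
      if AndAdj I D c d then (1 : ZMod 2) else 0 := by
  rw [qform_add' I D, qform_single I hI, qform_single I hI, qform_zero, polar_basis I hI hS]
  simp only [zero_add]

/-- **Polar vanishing from four equal values**: if `Q_D` takes one value at `x₀, x₀ + w, x₀ + w', x₀ + w + w'` then `B_D(w, w') = 0`. -/
theorem polar_eq_zero_of_const (I : LocalMap 4 n m) (D : Finset (Fin m)) {x₀ w w' : Fin n → ZMod 2} {c : ZMod 2}
    (h0 : qform D (fun j => I.vars j 2) (fun j => I.vars j 3) x₀ = c)
    (h1 : qform D (fun j => I.vars j 2) (fun j => I.vars j 3) (x₀ + w) = c)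
    (h2 : qform D (fun j => I.vars j 2) (fun j => I.vars j 3) (x₀ + w') = c)
    (h3 : qform D (fun j => I.vars j 2) (fun j => I.vars j 3) (x₀ + w + w') = c) :
    polar D (fun j => I.vars j 2) (fun j => I.vars j 3) w w' = 0 := by
  have hA := qform_add' I D (x₀ + w) w'
  have hB := qform_add' I D x₀ w'
  have hlin : polar D (fun j => I.vars j 2) (fun j => I.vars j 3) (x₀ + w) w' =
      polar D (fun j => I.vars j 2) (fun j => I.vars j 3) x₀ w' + polar D (fun j => I.vars j 2) (fun j => I.vars j 3) w w' := by
    rw [LinearMap.map_add₂]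
  linear_combination -hlin - hA + hB + h3 - h1 - h2 + h0

/-- **Linear part from two equal values**: if `Q_D(x₀) = Q_D(x₀ + w)` then `Q_D(w) + B_D(x₀, w) = 0` (using `Q_D(0) = 0`). -/
theorem qform_add_polar_eq_zero (I : LocalMap 4 n m) (D : Finset (Fin m)) {x₀ w : Fin n → ZMod 2} {c : ZMod 2}
    (h0 : qform D (fun j => I.vars j 2) (fun j => I.vars j 3) x₀ = c)
    (h1 : qform D (fun j => I.vars j 2) (fun j => I.vars j 3) (x₀ + w) = c) :
    qform D (fun j => I.vars j 2) (fun j => I.vars j 3) w + polar D (fun j => I.vars j 2) (fun j => I.vars j 3) x₀ w = 0 := by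
  have hA := qform_add' I D x₀ w
  rw [qform_zero] at hA
  linear_combination -hA + h1 - h0

/-- Two indicators summing to zero in `𝔽₂` agree. -/
private theorem iff_of_indicator {A C : Prop} [Decidable A] [Decidable C]
    (h : (if A then (1 : ZMod 2) else 0) + (if C then 1 else 0) = 0) : A ↔ C := by
  by_cases hA : A <;> by_cases hC : C <;> simp_all

/-- A vanishing indicator in `𝔽₂`. -/
private theorem not_of_indicator {A : Prop} [Decidable A] (h : (if A then (1 : ZMod 2) else 0) = 0) : ¬ A := by
  by_cases hA : A <;> simp_all

/-! ## Combinatorics of AND-graphs: symmetry, second neighbours, shared variables -/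

/-- AND-adjacency is symmetric. -/
theorem andAdj_comm (I : LocalMap 4 n m) (D : Finset (Fin m)) (c d : Fin n) : AndAdj I D c d ↔ AndAdj I D d c := by
  constructor <;> rintro ⟨j, hj, h⟩ <;> exact ⟨j, hj, h.symm⟩

/-- From an adjacency `v ~ x` with `x` different from both variables of an output `k ∋ v` (AND pair `{v, d}`): another output of `D`
containing `v`. -/
theorem exists_other (I : LocalMap 4 n m) {D : Finset (Fin m)} {k : Fin m} {v d x : Fin n}
    (hk : (I.vars k 2 = v ∧ I.vars k 3 = d) ∨ (I.vars k 2 = d ∧ I.vars k 3 = v)) (hadj : AndAdj I D v x) (hxd : x ≠ d) (hxv : x ≠ v) :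
    ∃ k' ∈ D, k' ≠ k ∧ v ∈ andPair I k' := by
  obtain ⟨k', hk', hp⟩ := hadj
  refine ⟨k', hk', fun heq => ?_, (mem_andPair_iff I k' v).2 ?_⟩
  · subst heq
    rcases hk with ⟨h2, h3⟩ | ⟨h2, h3⟩ <;> rcases hp with ⟨g2, g3⟩ | ⟨g2, g3⟩
    · exact hxd (g3.symm.trans h3)
    · exact hxv (g2.symm.trans h2)
    · exact hxv (g3.symm.trans h3)
    · exact hxd (g2.symm.trans h2)
  · rcases hp with ⟨g2, -⟩ | ⟨-, g3⟩
    · exact Or.inl g2.symm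
    · exact Or.inr g3.symm

/-- **Second neighbours give shared variables**: if in every adjacency `v ~ d` of `D` the variable `v` has a second neighbour `x ∉ {v, d}`,
then every AND variable of every output of `D` lies in another output of `D`. -/
theorem shared_of_second (I : LocalMap 4 n m) {D : Finset (Fin m)}
    (h : ∀ v d, AndAdj I D v d → ∃ x, x ≠ d ∧ x ≠ v ∧ AndAdj I D v x) :
    ∀ k ∈ D, ∀ v ∈ andPair I k, ∃ k' ∈ D, k' ≠ k ∧ v ∈ andPair I k' := by
  intro k hk v hv
  rcases (mem_andPair_iff I k v).1 hv with rfl | rfl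
  · obtain ⟨x, hxd, hxv, hadj⟩ := h _ (I.vars k 3) ⟨k, hk, Or.inl ⟨rfl, rfl⟩⟩
    exact exists_other I (Or.inl ⟨rfl, rfl⟩) hadj hxd hxv
  · obtain ⟨x, hxd, hxv, hadj⟩ := h _ (I.vars k 2) ⟨k, hk, Or.inr ⟨rfl, rfl⟩⟩
    exact exists_other I (Or.inr ⟨rfl, rfl⟩) hadj hxd hxv

/-- **Fundamental sets are not all-shared.**  If every AND variable of every output of `D` lies in another output of `D`, where `D` is a
fundamental set (`e ∉ D`, `D + e` everywhere even, `#D ≤ r`) of a pure `(r,3/2)`-expanding instance with simple overlaps, then `False`: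
the boundary of `D` would consist of at most two XOR vertices (`card_xor_bdry_le_two_of_even`), against `3·#D ≤ 2·#bdry(D)` and `2 ≤ #D`. -/
theorem false_of_shared (I : LocalMap 4 n m) (hI : I.IsPure xorAndPred) (hS : SimpleOverlap I) {r : ℕ} (hB : BoundaryExpanding r I)
    {D : Finset (Fin m)} {e : Fin m} (hDr : D.card ≤ r) (he : e ∉ D) (heven : ∀ w, Even (xpdeg I (insert e D) w))
    (hsh : ∀ k ∈ D, ∀ v ∈ andPair I k, ∃ k' ∈ D, k' ≠ k ∧ v ∈ andPair I k') : False := by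
  have hbd : bdry I D ⊆ (bdry I D).filter fun v => ∀ j ∈ D, v ∉ andPair I j := by
    intro v hv
    refine mem_filter.2 ⟨hv, fun j hj hvj => ?_⟩
    obtain ⟨j', hj', hne, hvj'⟩ := hsh j hj v hvj
    exact not_mem_bdry_of_two I hj hj' hne.symm (andPair_subset_varSet I j hvj) (andPair_subset_varSet I j' hvj') hv
  have h2 := two_le_card_of_even I hI hS he heven
  have hx := card_xor_bdry_le_two_of_even I hI he heven
  have hexp := hB D hDr
  have := card_le_card hbd
  omega

/-- **Constancy on a coordinate hyperplane is impossible.**  If `Q_D ≡ c` on `{x_p = 0}` for a fundamental set `D`, then (as `Q_D(0) = 0`)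
`Q_D(e_c + e_d) = 0` for all `c, d ≠ p`, so every output of `D` contains `p` — a star, excluded by `not_star_of_even`. -/
theorem false_of_const_on_hyperplane (I : LocalMap 4 n m) (hI : I.IsPure xorAndPred) (hS : SimpleOverlap I) {D : Finset (Fin m)} {e : Fin m}
    (he : e ∉ D) (heven : ∀ w, Even (xpdeg I (insert e D) w)) {p : Fin n} {c : ZMod 2}
    (hc : ∀ x : Fin n → ZMod 2, x p = 0 → qform D (fun j => I.vars j 2) (fun j => I.vars j 3) x = c) : False := by
  have hc0 : c = 0 := by rw [← hc 0 rfl, qform_zero]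
  refine not_star_of_even I hI hS he heven ⟨p, fun k hk => ?_⟩
  by_contra hp
  rw [mem_andPair_iff] at hp
  push Not at hp
  have hval := hc ((Pi.single (I.vars k 2) (1 : ZMod 2) : Fin n → ZMod 2) + Pi.single (I.vars k 3) 1)
    (by rw [Pi.add_apply, Pi.single_eq_of_ne hp.1, Pi.single_eq_of_ne hp.2, add_zero])
  rw [qform_pair I hI hS, if_pos ⟨k, hk, Or.inl ⟨rfl, rfl⟩⟩, hc0] at hval
  exact one_ne_zero hval

/-! ## Case 1: constancy on the flat `{x_p = x_q = 1}` -/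

/-- Case-1 engine.  AND-graph of `D` with: no output off `{p, q}`, paired adjacencies `p ~ i ↔ q ~ i` for `i ∉ {p, q}`, and no star.  Then
for every `d` the variable `p` has a neighbour `x ∉ {p, d}`. -/
theorem second_of_pair (I : LocalMap 4 n m) (hI : I.IsPure xorAndPred) {D : Finset (Fin m)} {p q : Fin n}
    (h1a : ∀ i i', i ≠ p → i ≠ q → i' ≠ p → i' ≠ q → ¬ AndAdj I D i i')
    (h1b : ∀ i, i ≠ p → i ≠ q → (AndAdj I D p i ↔ AndAdj I D q i))
    (hns : ∀ v, ∃ k ∈ D, v ∉ andPair I k) (d : Fin n) :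
    ∃ x, x ≠ d ∧ x ≠ p ∧ AndAdj I D p x := by
  by_cases hdq : d = q
  · -- an output avoiding `p` contains `q` and an outer `i` with `q ~ i`, hence `p ~ i`
    obtain ⟨k, hk, hpk⟩ := hns p
    rw [mem_andPair_iff] at hpk
    push Not at hpk
    obtain ⟨i, hiq, hip, hqi⟩ : ∃ i, i ≠ q ∧ i ≠ p ∧ AndAdj I D q i := by
      by_cases h2 : I.vars k 2 = q
      · exact ⟨I.vars k 3, fun h => and_ne I hI k (h2.trans h.symm), fun h => hpk.2 h.symm, k, hk, Or.inl ⟨h2, rfl⟩⟩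
      · by_cases h3 : I.vars k 3 = q
        · exact ⟨I.vars k 2, h2, fun h => hpk.1 h.symm, k, hk, Or.inr ⟨rfl, h3⟩⟩
        · exact absurd ⟨k, hk, Or.inl ⟨rfl, rfl⟩⟩ (h1a _ _ (fun h => hpk.1 h.symm) h2 (fun h => hpk.2 h.symm) h3)
    exact ⟨i, fun h => hiq (h.trans hdq), hip, (h1b i hip hiq).2 hqi⟩
  · -- `d` is outer; an output avoiding `d` touches `{p, q}` and yields the second neighbour
    obtain ⟨k, hk, hdk⟩ := hns d
    rw [mem_andPair_iff] at hdk
    push Not at hdk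
    by_cases hp2 : I.vars k 2 = p
    · exact ⟨I.vars k 3, fun h => hdk.2 h.symm, fun h => and_ne I hI k (hp2.trans h.symm), k, hk, Or.inl ⟨hp2, rfl⟩⟩
    by_cases hp3 : I.vars k 3 = p
    · exact ⟨I.vars k 2, fun h => hdk.1 h.symm, hp2, k, hk, Or.inr ⟨rfl, hp3⟩⟩
    by_cases hq2 : I.vars k 2 = q
    · have hy : AndAdj I D q (I.vars k 3) := ⟨k, hk, Or.inl ⟨hq2, rfl⟩⟩
      have hyq : I.vars k 3 ≠ q := fun h => and_ne I hI k (hq2.trans h.symm)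
      exact ⟨I.vars k 3, fun h => hdk.2 h.symm, hp3, (h1b _ hp3 hyq).2 hy⟩
    by_cases hq3 : I.vars k 3 = q
    · have hy : AndAdj I D q (I.vars k 2) := ⟨k, hk, Or.inr ⟨rfl, hq3⟩⟩
      exact ⟨I.vars k 2, fun h => hdk.1 h.symm, hp2, (h1b _ hp2 hq2).2 hy⟩
    exact absurd ⟨k, hk, Or.inl ⟨rfl, rfl⟩⟩ (h1a _ _ hp2 hq2 hp3 hq3)

/-- **Constancy on the flat `{x_p = x_q = 1}` is impossible** (`p ≠ q`, `D` a fundamental set with `#D ≤ r` of a pure `(r,3/2)`-expanding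
instance with simple overlaps).  From `Q_D ≡ c` there: no output of `D` off `{p, q}` (polar vanishing on flat directions) and `p ~ i ↔ q ~ i`
off `{p, q}` (`Q_D(e_i) = 0`); such an AND-graph is a star or all-shared. -/
theorem false_of_const_on_pair_flat (I : LocalMap 4 n m) (hI : I.IsPure xorAndPred) (hS : SimpleOverlap I) {r : ℕ}
    (hB : BoundaryExpanding r I) {D : Finset (Fin m)} {e : Fin m} (hDr : D.card ≤ r) (he : e ∉ D)
    (heven : ∀ w, Even (xpdeg I (insert e D) w)) {p q : Fin n} (hpq : p ≠ q) {c : ZMod 2}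
    (hc : ∀ x : Fin n → ZMod 2, x p = 1 → x q = 1 → qform D (fun j => I.vars j 2) (fun j => I.vars j 3) x = c) : False := by
  classical
  -- the base point `x₀ = e_p + e_q` of the flat and its directions
  set x₀ : Fin n → ZMod 2 := Pi.single p 1 + Pi.single q 1 with hx₀
  have hx₀p : x₀ p = 1 := by rw [hx₀, Pi.add_apply, Pi.single_eq_same, Pi.single_eq_of_ne hpq, add_zero]
  have hx₀q : x₀ q = 1 := by rw [hx₀, Pi.add_apply, Pi.single_eq_of_ne hpq.symm, Pi.single_eq_same, zero_add]
  have h0 := hc _ hx₀p hx₀q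
  have mem : ∀ w : Fin n → ZMod 2, w p = 0 → w q = 0 → qform D (fun j => I.vars j 2) (fun j => I.vars j 3) (x₀ + w) = c :=
    fun w hp hq => hc _ (by rw [Pi.add_apply, hx₀p, hp, add_zero]) (by rw [Pi.add_apply, hx₀q, hq, add_zero])
  have hep : ∀ i, i ≠ p → (Pi.single i (1 : ZMod 2) : Fin n → ZMod 2) p = 0 := fun i hip => Pi.single_eq_of_ne (Ne.symm hip) _
  have heq : ∀ i, i ≠ q → (Pi.single i (1 : ZMod 2) : Fin n → ZMod 2) q = 0 := fun i hiq => Pi.single_eq_of_ne (Ne.symm hiq) _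
  -- (1a) no output off `{p, q}`
  have h1a : ∀ i i', i ≠ p → i ≠ q → i' ≠ p → i' ≠ q → ¬ AndAdj I D i i' := by
    intro i i' hip hiq hi'p hi'q
    have m3 : qform D (fun j => I.vars j 2) (fun j => I.vars j 3) (x₀ + Pi.single i 1 + Pi.single i' 1) = c := by
      rw [add_assoc]
      refine mem _ ?_ ?_
      · rw [Pi.add_apply, hep i hip, hep i' hi'p, add_zero]
      · rw [Pi.add_apply, heq i hiq, heq i' hi'q, add_zero]
    have h := polar_eq_zero_of_const I D h0 (mem _ (hep i hip) (heq i hiq)) (mem _ (hep i' hi'p) (heq i' hi'q)) m3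
    rw [polar_basis I hI hS] at h
    exact not_of_indicator h
  -- (1b) paired adjacencies
  have h1b : ∀ i, i ≠ p → i ≠ q → (AndAdj I D p i ↔ AndAdj I D q i) := by
    intro i hip hiq
    have h := qform_add_polar_eq_zero I D h0 (mem _ (hep i hip) (heq i hiq))
    rw [qform_single I hI, hx₀, LinearMap.map_add₂, polar_basis I hI hS, polar_basis I hI hS, zero_add] at h
    exact iff_of_indicator h
  -- star or all-shared
  by_cases hstar : ∃ v, ∀ k ∈ D, v ∈ andPair I k
  · exact not_star_of_even I hI hS he heven hstar
  push Not at hstar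
  refine false_of_shared I hI hS hB hDr he heven (shared_of_second I fun v d hvd => ?_)
  by_cases hvp : v = p
  · subst hvp
    exact second_of_pair I hI h1a h1b hstar d
  by_cases hvq : v = q
  · subst hvq
    exact second_of_pair I hI (fun i i' a1 a2 c1 c2 => h1a i i' a2 a1 c2 c1) (fun i hiq hip => (h1b i hip hiq).symm) hstar d
  -- `v` outer: then `d ∈ {p, q}`
  by_cases hdp : d = p
  · rw [hdp] at hvd
    have h : AndAdj I D q v := (h1b v hvp hvq).1 ((andAdj_comm I D v p).1 hvd)
    exact ⟨q, by rw [hdp]; exact hpq.symm, Ne.symm hvq, (andAdj_comm I D q v).1 h⟩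
  by_cases hdq : d = q
  · rw [hdq] at hvd
    have h : AndAdj I D p v := (h1b v hvp hvq).2 ((andAdj_comm I D v q).1 hvd)
    exact ⟨p, by rw [hdq]; exact hpq, Ne.symm hvp, (andAdj_comm I D p v).1 h⟩
  exact absurd hvd (h1a v d hvp hvq hdp hdq)

/-! ## Case 2: constancy on the flat `{x_σ = 1, x_b + x_{b'} = 1}` -/

/-- Case-2 engine (for the variable `b`).  AND-graph of `D` with `σ ~ b`, no output off `{σ, b, b'}`, `b ~ i ↔ b' ~ i` for outer `i`, and no
star.  Then for every `d` the variable `b` has a neighbour `x ∉ {b, d}`. -/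
theorem second_of_sigma (I : LocalMap 4 n m) (hI : I.IsPure xorAndPred) {D : Finset (Fin m)} {σ b b' : Fin n} (hσb : σ ≠ b)
    (hin : AndAdj I D σ b)
    (h2a : ∀ i i', i ≠ σ → i ≠ b → i ≠ b' → i' ≠ σ → i' ≠ b → i' ≠ b' → ¬ AndAdj I D i i')
    (h2b : ∀ i, i ≠ σ → i ≠ b → i ≠ b' → (AndAdj I D b i ↔ AndAdj I D b' i))
    (hns : ∀ v, ∃ k ∈ D, v ∉ andPair I k) (d : Fin n) :
    ∃ x, x ≠ d ∧ x ≠ b ∧ AndAdj I D b x := by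
  by_cases hdσ : d = σ
  · subst hdσ
    -- an output avoiding `σ` touches `{b, b'}`
    obtain ⟨k, hk, hσk⟩ := hns d
    rw [mem_andPair_iff] at hσk
    push Not at hσk
    by_cases hb2 : I.vars k 2 = b
    · exact ⟨I.vars k 3, fun h => hσk.2 h.symm, fun h => and_ne I hI k (hb2.trans h.symm), k, hk, Or.inl ⟨hb2, rfl⟩⟩
    by_cases hb3 : I.vars k 3 = b
    · exact ⟨I.vars k 2, fun h => hσk.1 h.symm, hb2, k, hk, Or.inr ⟨rfl, hb3⟩⟩
    by_cases hb'2 : I.vars k 2 = b'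
    · have hy : AndAdj I D b' (I.vars k 3) := ⟨k, hk, Or.inl ⟨hb'2, rfl⟩⟩
      have hyb' : I.vars k 3 ≠ b' := fun h => and_ne I hI k (hb'2.trans h.symm)
      exact ⟨I.vars k 3, fun h => hσk.2 h.symm, hb3, (h2b _ (fun h => hσk.2 h.symm) hb3 hyb').2 hy⟩
    by_cases hb'3 : I.vars k 3 = b'
    · have hy : AndAdj I D b' (I.vars k 2) := ⟨k, hk, Or.inr ⟨rfl, hb'3⟩⟩
      exact ⟨I.vars k 2, fun h => hσk.1 h.symm, hb2, (h2b _ (fun h => hσk.1 h.symm) hb2 hb'2).2 hy⟩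
    exact absurd ⟨k, hk, Or.inl ⟨rfl, rfl⟩⟩
      (h2a _ _ (fun h => hσk.1 h.symm) hb2 hb'2 (fun h => hσk.2 h.symm) hb3 hb'3)
  · exact ⟨σ, fun h => hdσ h.symm, hσb, (andAdj_comm I D σ b).1 hin⟩

/-- **Constancy on the flat `{x_σ = 1, x_b + x_{b'} = 1}` is impossible** when `σ ~ b` in `D` (`σ, b, b'` distinct; `D` a fundamental set with
`#D ≤ r` of a pure `(r,3/2)`-expanding instance with simple overlaps).  From `Q_D ≡ c` there: no output off `{σ, b, b'}`, `b ~ i ↔ b' ~ i` and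
`σ ~ i ↔ b ~ i` for outer `i`, and `σ ~ b ↔ σ ~ b'`; such an AND-graph is a star (`D = {σb, σb'}`) or all-shared. -/
theorem false_of_const_on_sigma_flat (I : LocalMap 4 n m) (hI : I.IsPure xorAndPred) (hS : SimpleOverlap I) {r : ℕ}
    (hB : BoundaryExpanding r I) {D : Finset (Fin m)} {e : Fin m} (hDr : D.card ≤ r) (he : e ∉ D)
    (heven : ∀ w, Even (xpdeg I (insert e D) w)) {σ b b' : Fin n} (hσb : σ ≠ b) (hσb' : σ ≠ b') (hbb' : b ≠ b')
    (hin : AndAdj I D σ b) {c : ZMod 2}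
    (hc : ∀ x : Fin n → ZMod 2, x σ = 1 → x b + x b' = 1 → qform D (fun j => I.vars j 2) (fun j => I.vars j 3) x = c) : False := by
  classical
  -- base point `x₀ = e_σ + e_b`, directions `e_i` (outer) and `u = e_b + e_{b'}`
  have one_one : (1 : ZMod 2) + 1 = 0 := by decide
  have hsingle : ∀ i i' : Fin n, i' ≠ i → (Pi.single i (1 : ZMod 2) : Fin n → ZMod 2) i' = 0 := fun i i' h => Pi.single_eq_of_ne h _
  have hsame : ∀ i : Fin n, (Pi.single i (1 : ZMod 2) : Fin n → ZMod 2) i = 1 := fun i => Pi.single_eq_same i _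
  set x₀ : Fin n → ZMod 2 := Pi.single σ 1 + Pi.single b 1 with hx₀
  have hx₀σ : x₀ σ = 1 := by rw [hx₀, Pi.add_apply, hsame, hsingle b σ hσb, add_zero]
  have hx₀b : x₀ b + x₀ b' = 1 := by
    rw [hx₀, Pi.add_apply, Pi.add_apply, hsingle σ b (Ne.symm hσb), hsame, hsingle σ b' (Ne.symm hσb'), hsingle b b' (Ne.symm hbb')]
    ring
  have h0 := hc _ hx₀σ hx₀b
  have mem : ∀ w : Fin n → ZMod 2, w σ = 0 → w b + w b' = 0 →
      qform D (fun j => I.vars j 2) (fun j => I.vars j 3) (x₀ + w) = c := by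
    intro w hσ hb
    refine hc _ (by rw [Pi.add_apply, hx₀σ, hσ, add_zero]) ?_
    rw [Pi.add_apply, Pi.add_apply]
    linear_combination hx₀b + hb
  -- the directions
  set u : Fin n → ZMod 2 := Pi.single b 1 + Pi.single b' 1 with hu
  have huσ : u σ = 0 := by rw [hu, Pi.add_apply, hsingle b σ hσb, hsingle b' σ hσb', add_zero]
  have hub : u b + u b' = 0 := by
    rw [hu, Pi.add_apply, Pi.add_apply, hsame, hsingle b' b hbb', hsingle b b' (Ne.symm hbb'), hsame]
    linear_combination one_one
  have heσ : ∀ i, i ≠ σ → (Pi.single i (1 : ZMod 2) : Fin n → ZMod 2) σ = 0 := fun i h => hsingle i σ (Ne.symm h)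
  have heb : ∀ i, i ≠ b → i ≠ b' → (Pi.single i (1 : ZMod 2) : Fin n → ZMod 2) b + (Pi.single i (1 : ZMod 2) : Fin n → ZMod 2) b' = 0 :=
    fun i hb hb' => by rw [hsingle i b (Ne.symm hb), hsingle i b' (Ne.symm hb'), add_zero]
  -- (2a) no output off `{σ, b, b'}`
  have h2a : ∀ i i', i ≠ σ → i ≠ b → i ≠ b' → i' ≠ σ → i' ≠ b → i' ≠ b' → ¬ AndAdj I D i i' := by
    intro i i' hiσ hib hib' hi'σ hi'b hi'b'
    have m3 : qform D (fun j => I.vars j 2) (fun j => I.vars j 3) (x₀ + Pi.single i 1 + Pi.single i' 1) = c := by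
      rw [add_assoc]
      refine mem _ ?_ ?_
      · rw [Pi.add_apply, heσ i hiσ, heσ i' hi'σ, add_zero]
      · rw [Pi.add_apply, Pi.add_apply]
        linear_combination heb i hib hib' + heb i' hi'b hi'b'
    have h := polar_eq_zero_of_const I D h0 (mem _ (heσ i hiσ) (heb i hib hib')) (mem _ (heσ i' hi'σ) (heb i' hi'b hi'b')) m3
    rw [polar_basis I hI hS] at h
    exact not_of_indicator h
  -- (2b) `b ~ i ↔ b' ~ i` for outer `i`
  have h2b : ∀ i, i ≠ σ → i ≠ b → i ≠ b' → (AndAdj I D b i ↔ AndAdj I D b' i) := by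
    intro i hiσ hib hib'
    have m3 : qform D (fun j => I.vars j 2) (fun j => I.vars j 3) (x₀ + Pi.single i 1 + u) = c := by
      rw [add_assoc]
      refine mem _ ?_ ?_
      · rw [Pi.add_apply, heσ i hiσ, huσ, add_zero]
      · rw [Pi.add_apply, Pi.add_apply]
        linear_combination heb i hib hib' + hub
    have h := polar_eq_zero_of_const I D h0 (mem _ (heσ i hiσ) (heb i hib hib')) (mem _ huσ hub) m3
    rw [hu, map_add, polar_basis I hI hS, polar_basis I hI hS] at h
    rw [andAdj_comm I D b i, andAdj_comm I D b' i]
    exact iff_of_indicator h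
  -- (2c) `σ ~ i ↔ b ~ i` for outer `i`
  have h2c : ∀ i, i ≠ σ → i ≠ b → i ≠ b' → (AndAdj I D σ i ↔ AndAdj I D b i) := by
    intro i hiσ hib hib'
    have h := qform_add_polar_eq_zero I D h0 (mem _ (heσ i hiσ) (heb i hib hib'))
    rw [qform_single I hI, hx₀, LinearMap.map_add₂, polar_basis I hI hS, polar_basis I hI hS, zero_add] at h
    exact iff_of_indicator h
  -- (2d) `σ ~ b'`
  have hin' : AndAdj I D σ b' := by
    have h := qform_add_polar_eq_zero I D h0 (mem _ huσ hub)
    rw [hu, qform_pair I hI hS, hx₀, LinearMap.map_add₂, map_add, map_add, polar_self_and, polar_basis I hI hS, polar_basis I hI hS,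
      polar_basis I hI hS, if_pos hin] at h
    by_contra hn
    rw [if_neg hn] at h
    split_ifs at h <;> exact absurd h (by decide)
  -- star or all-shared
  by_cases hstar : ∃ v, ∀ k ∈ D, v ∈ andPair I k
  · exact not_star_of_even I hI hS he heven hstar
  push Not at hstar
  refine false_of_shared I hI hS hB hDr he heven (shared_of_second I fun v d hvd => ?_)
  by_cases hvσ : v = σ
  · subst hvσ
    by_cases hdb : d = b
    · exact ⟨b', fun h => hbb' (h.trans hdb).symm, Ne.symm hσb', hin'⟩
    · exact ⟨b, fun h => hdb h.symm, Ne.symm hσb, hin⟩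
  by_cases hvb : v = b
  · subst hvb
    exact second_of_sigma I hI hσb hin h2a h2b hstar d
  by_cases hvb' : v = b'
  · subst hvb'
    exact second_of_sigma I hI hσb' hin' (fun i i' a1 a2 a3 c1 c2 c3 => h2a i i' a1 a3 a2 c1 c3 c2)
      (fun i hiσ hib' hib => (h2b i hiσ hib hib').symm) hstar d
  -- `v` outer: then `d ∈ {σ, b, b'}`
  have hdv : AndAdj I D d v := (andAdj_comm I D v d).1 hvd
  by_cases hdσ : d = σ
  · rw [hdσ] at hdv
    exact ⟨b, by rw [hdσ]; exact Ne.symm hσb, Ne.symm hvb, (andAdj_comm I D b v).1 ((h2c v hvσ hvb hvb').1 hdv)⟩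
  by_cases hdb : d = b
  · rw [hdb] at hdv
    exact ⟨σ, by rw [hdb]; exact hσb, Ne.symm hvσ, (andAdj_comm I D σ v).1 ((h2c v hvσ hvb hvb').2 hdv)⟩
  by_cases hdb' : d = b'
  · rw [hdb'] at hdv
    exact ⟨b, by rw [hdb']; exact hbb', Ne.symm hvb, (andAdj_comm I D b v).1 ((h2b v hvσ hvb hvb').2 hdv)⟩
  exact absurd hvd (h2a v d hvσ hvb hvb' hdσ hdb hdb')

end Summit.PneNP.PneNP.Theorems.PstarChordBridgeFlat
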